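import Mathlib
import HarnessLib
import Summits.Ventures.LatticeQCDFlow.Exactness.FlowedChargeLocality

/-!
# The measured (RK3-flowed) slab ENERGY of a slice deep in the half-space is a half-space observable, and its centred correlator with the mirror slice is NON-NEGATIVE, for every `β`

HONEST FRAMING: exact (Metropolis-corrected) sampling algorithms for lattice gauge theory;
figures of merit are autocorrelation/cost numbers at stated couplings and volumes; no
continuum-physics claim.

Venture `LatticeQCDFlow` (cell pub-lqcd), topic `Exactness`, FANOUT row 21 (`su3-base`: the row's second scored observable is the
flowed clover energy `t²E`).  The `0⁺⁺` twin of row 21's `Exactness/FlowedChargeLocality` (whose §1–§3 — the time-locality of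
the RK3 scheme with radius `3m`, `iterate_wilsonFlowRK3_eq_of_agree` — are imported): the clover ENERGY density is EVEN under
the site reflection (Literature `flowedCloverEnergy_zero_reflect`), so the same support argument and the same
Osterwalder–Seiler positivity give the opposite sign.  NEW WORK of the cell, def-free; nothing cited as a fact; no number.

* §1 **`dependsOn_rk3SlabEnergy`** — for `3m + 1 ≤ t.val`, `t.val + 3m + 2 ≤ L/2` the flowed slab energy
  `Σ_{x₀ = t} S_x ∘ RK3_{ε'}^m` depends only on the site-positive and shared links.
* §2 **`integral_rk3SlabEnergy_sub_mul_mirror_nonneg`** — for `SU(n)`, `L` even, EVERY `β`, `ε'`, `m`, every constant `a` and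
  every such slice: `0 ≤ ∫ ((Σ_{x₀=t} S_x ∘ RK3^m) − a)((Σ_{x₀=t} S_{θ'x} ∘ RK3^m) − a) dμ_β`.
NOT CLAIMED: the same caveat as the parent — the certified footprint `3m` is the scheme's strict support, linear in `m`, not the
diffusive `√(8t)`; link plane; spatial windows; numbers.
-/

noncomputable section

namespace Summit.Ventures.LatticeQCDFlow.Exactness

open MeasureTheory
open Literature.MathematicalPhysics.QuantumFieldTheory
open Literature.MathematicalPhysics.QuantumLattice (flowedCloverEnergy flowedCloverEnergy_zero_reflect continuous_flowedCloverEnergy_zero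
  exists_abs_flowedCloverEnergy_zero_le cloverEdges fundamentalRep continuous_fundamentalRep fundamentalRep_mem_unitaryGroup)
open Summit.Ventures.LatticeQCDFlow.Scoring (wilsonFlowRK3 iterate_wilsonFlowRK3_negReflect continuous_iterate_wilsonFlowRK3)

/-! ## §1 The flowed slab ENERGY of a slice deep in the half-space is an observable of the site-positive and shared links -/

section Support

variable {L n : ℕ} [NeZero L]

/-- **SUPPORT OF THE FLOWED SLAB ENERGY**: for a slice `t` with `3m + 1 ≤ t.val` and `t.val + 3m + 2 ≤ L/2`, the flowed slab
energy `Σ_{x : x₀ = t} S_x(RK3_{ε'}^m U)` depends only on the site-positive and shared links of the site reflection. -/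
theorem dependsOn_rk3SlabEnergy (ε' : ℝ) (m : ℕ) (t : ZMod L) (hlo : 3 * m + 1 ≤ t.val) (hhi : t.val + 3 * m + 2 ≤ L / 2) :
    DependsOn (fun U : GaugeConfig 4 L (Matrix.specialUnitaryGroup (Fin n) ℂ) =>
        ∑ x ∈ Finset.univ.filter (fun x : Site 4 L => x 0 = t),
          flowedCloverEnergy (fundamentalRep (Fin n)) 0 x ((wilsonFlowRK3 ε')^[m] U))
      ((WilsonSiteRP.sitePosEdges ∪ WilsonSiteRP.sharedEdges : Finset (Edge 4 L)) : Set (Edge 4 L)) := by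
  have hL2 : L / 2 < L := Nat.div_lt_self (Nat.pos_of_ne_zero (NeZero.ne L)) one_lt_two
  intro U V hUV
  refine Finset.sum_congr rfl fun x hx => ?_
  have hxt : x 0 = t := by simpa using hx
  -- the flowed fields agree on every link based at a time value in `[t − 1, t + 1]`
  have hagree : ∀ e : Edge 4 L, t.val - 1 ≤ (e.1 0).val → (e.1 0).val ≤ t.val + 1 →
      (wilsonFlowRK3 ε')^[m] U e = (wilsonFlowRK3 ε')^[m] V e := by
    refine iterate_wilsonFlowRK3_eq_of_agree ε' m (lo := t.val - 1) (hi := t.val + 1) (by omega) (by omega) ?_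
    intro e h1 h2
    apply hUV
    simp only [Finset.coe_union, Set.mem_union, Finset.mem_coe, WilsonSiteRP.mem_sitePosEdges,
      WilsonSiteRP.mem_sharedEdges, WilsonSiteRP.IsSitePosEdge, WilsonSiteRP.IsSharedEdge]
    by_cases he0 : e.2 = 0
    · left; rw [if_pos he0]; omega
    · rw [if_neg he0]
      by_cases hz : (e.1 0).val = 0
      · right; exact ⟨he0, Or.inl hz⟩
      · left; omega
  -- links based at a time in `{x₀, x₀ − 1, x₀ + 1}` are therefore read identically
  obtain ⟨hp, hs⟩ := zmod_val_pred_succ (t := x 0) (by rw [hxt]; omega) (by rw [hxt]; omega)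
  have hb : ∀ e : Edge 4 L, (e.1 0 = x 0 ∨ e.1 0 = x 0 - 1 ∨ e.1 0 = x 0 + 1) →
      (wilsonFlowRK3 ε')^[m] U e = (wilsonFlowRK3 ε')^[m] V e := by
    intro e he
    refine hagree e ?_ ?_ <;> rcases he with h | h | h <;> rw [h] <;> (try rw [hp]) <;> (try rw [hs]) <;> rw [hxt] <;> omega
  -- the clover at `x` reads only links of the six coordinate-plane clovers, all based at such times
  have h0 : ∀ i : Fin 4, i ≠ 0 → ∀ e ∈ cloverEdges x 0 i, (wilsonFlowRK3 ε')^[m] U e = (wilsonFlowRK3 ε')^[m] V e := by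
    intro i hi e he
    apply hb
    simp only [cloverEdges, Finset.mem_insert, Finset.mem_singleton] at he
    rcases he with rfl | rfl | rfl | rfl | rfl | rfl | rfl | rfl | rfl | rfl | rfl | rfl <;>
      simp [Ne.symm hi, sub_eq_add_neg, add_comm]
  have hsp : ∀ i j : Fin 4, i ≠ 0 → j ≠ 0 → ∀ e ∈ cloverEdges x i j,
      (wilsonFlowRK3 ε')^[m] U e = (wilsonFlowRK3 ε')^[m] V e := by
    intro i j hi hj e he
    apply hb
    simp only [cloverEdges, Finset.mem_insert, Finset.mem_singleton] at he
    rcases he with rfl | rfl | rfl | rfl | rfl | rfl | rfl | rfl | rfl | rfl | rfl | rfl <;>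
      simp [Ne.symm hi, Ne.symm hj]
  have hC : ∀ μ ν : Fin 4, (μ = 0 ∧ ν ≠ 0) ∨ (μ ≠ 0 ∧ ν ≠ 0) →
      Literature.MathematicalPhysics.QuantumLattice.flowedClover (fundamentalRep (Fin n)) 0 ((wilsonFlowRK3 ε')^[m] U) x μ ν =
        Literature.MathematicalPhysics.QuantumLattice.flowedClover (fundamentalRep (Fin n)) 0 ((wilsonFlowRK3 ε')^[m] V) x μ ν := by
    intro μ ν h
    rcases h with ⟨hμ, hν⟩ | ⟨hμ, hν⟩
    · subst hμ
      exact Literature.MathematicalPhysics.QuantumLattice.flowedClover_zero_congr _ (h0 ν hν)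
    · exact Literature.MathematicalPhysics.QuantumLattice.flowedClover_zero_congr _ (hsp μ ν hμ hν)
  unfold flowedCloverEnergy
  refine Finset.sum_congr rfl fun μ _ => Finset.sum_congr rfl fun ν _ => ?_
  split_ifs with hμν
  · have h : (μ = 0 ∧ ν ≠ 0) ∨ (μ ≠ 0 ∧ ν ≠ 0) := by
      by_cases hμ : μ = 0
      · subst hμ; exact Or.inl ⟨rfl, ne_of_gt hμν⟩
      · exact Or.inr ⟨hμ, fun h => by subst h; exact absurd hμν (by simp)⟩
    rw [hC μ ν h]
  · rfl

end Support

/-! ## §2 The centred flowed slab-energy correlator across the site plane is non-negative — unconditionally in the stated range -/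

section Positivity

variable {L n : ℕ} [NeZero L]

/-- **THE MEASURED (RK3-FLOWED) SLAB ENERGY ACROSS THE SITE PLANE IS NON-NEGATIVELY CORRELATED WITH ITS MIRROR SLICE, CENTRED BY
ANY CONSTANT**: for `SU(n)` (fundamental), `L` even, EVERY real `β`, every `ε'`, `m`, every constant `a` and every slice `t` with
`3m + 1 ≤ t.val`, `t.val + 3m + 2 ≤ L/2`:
`0 ≤ ∫ ((Σ_{x₀=t} S_x ∘ RK3^m) − a) · ((Σ_{x₀=t} S_{θ'x} ∘ RK3^m) − a) dμ_β` (with `a = ⟨E_{m,t}⟩` the connected correlator of the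
measured `t²E`-type slab observable at separation `2 t.val` is non-negative). -/
theorem integral_rk3SlabEnergy_sub_mul_mirror_nonneg (hL : Even L) (β ε' : ℝ) (m : ℕ) (t : ZMod L) (a : ℝ)
    (hlo : 3 * m + 1 ≤ t.val) (hhi : t.val + 3 * m + 2 ≤ L / 2) :
    0 ≤ ∫ U, ((∑ x ∈ Finset.univ.filter (fun x : Site 4 L => x 0 = t),
          flowedCloverEnergy (fundamentalRep (Fin n)) 0 x ((wilsonFlowRK3 ε')^[m] U)) - a) *
        ((∑ x ∈ Finset.univ.filter (fun x : Site 4 L => x 0 = t),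
          flowedCloverEnergy (fundamentalRep (Fin n)) 0 (Site.negReflect x) ((wilsonFlowRK3 ε')^[m] U)) - a)
      ∂(wilsonMeasure (d := 4) (L := L) (fundamentalRep (Fin n)) β) := by
  set Φ : GaugeConfig 4 L (Matrix.specialUnitaryGroup (Fin n) ℂ) → GaugeConfig 4 L (Matrix.specialUnitaryGroup (Fin n) ℂ) :=
    (wilsonFlowRK3 ε')^[m] with hΦ
  have hΦm : Measurable Φ := (continuous_iterate_wilsonFlowRK3 ε' m).measurable
  have hρc := continuous_fundamentalRep (Fin n)
  have hρu : ∀ g : Matrix.specialUnitaryGroup (Fin n) ℂ, fundamentalRep (Fin n) g ∈ Matrix.unitaryGroup (Fin n) ℂ :=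
    fundamentalRep_mem_unitaryGroup
  have hFm : Measurable fun U : GaugeConfig 4 L (Matrix.specialUnitaryGroup (Fin n) ℂ) =>
      (∑ x ∈ Finset.univ.filter (fun x : Site 4 L => x 0 = t), flowedCloverEnergy (fundamentalRep (Fin n)) 0 x (Φ U)) - a :=
    (Finset.measurable_sum _ fun x _ => ((continuous_flowedCloverEnergy_zero _ hρc x).measurable).comp hΦm).sub measurable_const
  obtain ⟨C, hC⟩ : ∃ C : ℝ, ∀ (x : Site 4 L) (W : GaugeConfig 4 L (Matrix.specialUnitaryGroup (Fin n) ℂ)),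
      |flowedCloverEnergy (fundamentalRep (Fin n)) 0 x W| ≤ C := by
    choose c hc using fun x : Site 4 L => exists_abs_flowedCloverEnergy_zero_le (fundamentalRep (Fin n)) hρc (R := ZMod L) x
    exact ⟨Finset.univ.sup' ⟨0, Finset.mem_univ _⟩ c, fun x W => (hc x W).trans (Finset.le_sup' c (Finset.mem_univ x))⟩
  have hFb : ∃ K : ℝ, ∀ U : GaugeConfig 4 L (Matrix.specialUnitaryGroup (Fin n) ℂ),
      |(∑ x ∈ Finset.univ.filter (fun x : Site 4 L => x 0 = t), flowedCloverEnergy (fundamentalRep (Fin n)) 0 x (Φ U)) - a| ≤ K :=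
    ⟨(∑ x ∈ Finset.univ.filter (fun x : Site 4 L => x 0 = t), C) + |a|, fun U => (abs_sub _ _).trans (add_le_add
      ((Finset.abs_sum_le_sum_abs _ _).trans (Finset.sum_le_sum fun x _ => hC x (Φ U))) le_rfl)⟩
  have hdep : DependsOn (fun U : GaugeConfig 4 L (Matrix.specialUnitaryGroup (Fin n) ℂ) =>
      (∑ x ∈ Finset.univ.filter (fun x : Site 4 L => x 0 = t), flowedCloverEnergy (fundamentalRep (Fin n)) 0 x (Φ U)) - a)
      ((WilsonSiteRP.sitePosEdges ∪ WilsonSiteRP.sharedEdges : Finset (Edge 4 L)) : Set (Edge 4 L)) := by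
    intro U V hUV
    have h := dependsOn_rk3SlabEnergy (n := n) ε' m t hlo hhi hUV
    simp only at h
    simp only [hΦ, h]
  have key := FariaDaVeigaOCarroll2022.integral_mul_negReflect_nonneg (fundamentalRep (Fin n)) hL hρc β hFm hFb hdep
  -- evenness of the energy density and covariance of the flow under the site reflection
  have heven : ∀ (W : GaugeConfig 4 L (Matrix.specialUnitaryGroup (Fin n) ℂ)) (x : Site 4 L),
      flowedCloverEnergy (fundamentalRep (Fin n)) 0 x W.negReflect =
        flowedCloverEnergy (fundamentalRep (Fin n)) 0 (Site.negReflect x) W := fun W x =>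
    flowedCloverEnergy_zero_reflect (fundamentalRep (Fin n)) hρu (Site.negReflect (d := 4) (L := L))
      (fun z => by funext k; by_cases hk : k = 0 <;> [(subst hk; simp [Site.negReflect]; ring); simp [Site.negReflect, hk]])
      (fun z i hi => by funext k; by_cases hk : k = 0 <;> [(subst hk; simp [Site.negReflect, hi.symm]); simp [Site.negReflect, hk]])
      W W.negReflect (fun z => by unfold GaugeConfig.negReflect; rw [if_pos rfl]; rfl)
      (fun z i hi => by unfold GaugeConfig.negReflect; rw [if_neg hi]) x
  have hrefl : ∀ U : GaugeConfig 4 L (Matrix.specialUnitaryGroup (Fin n) ℂ),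
      (∑ x ∈ Finset.univ.filter (fun x : Site 4 L => x 0 = t), flowedCloverEnergy (fundamentalRep (Fin n)) 0 x (Φ U.negReflect)) =
        ∑ x ∈ Finset.univ.filter (fun x : Site 4 L => x 0 = t),
          flowedCloverEnergy (fundamentalRep (Fin n)) 0 (Site.negReflect x) (Φ U) := by
    intro U
    rw [hΦ, iterate_wilsonFlowRK3_negReflect]
    exact Finset.sum_congr rfl fun x _ => heven _ x
  simp only [hrefl] at key
  simpa [hΦ] using key

end Positivity

end Summit.Ventures.LatticeQCDFlow.Exactness
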